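import Summits.HodgeConjecture.HodgeConjecture.Theorems.F0P2aCohFormsContinuous     -- ★ continuity ∕ non-zero `L²` class of a cotangent form of the CM frame
import Summits.HodgeConjecture.HodgeConjecture.Theorems.F0P2dStubSCotFormL2Data      -- ★ `rightRegular_toLp_toQuotFun_eq_sum_two` (pointwise type relation ⇒ `L²` type relation)
import Literature.Geometry.ComplexHyperbolic.UnitBallIsotropy                       -- ★ `BallModel.irred`: no cotangent line of `𝔹²` is stable under the isotropy group
import HarnessLib

/-!
# Crux `H413`, programme P2 — a ONE-DIMENSIONAL discrete automorphic representation of `U(H)` carries NO holomorphic (and no antiholomorphic)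
# cotangent form: `finrank ℂ P = 1 ⇒ ¬ P.IsHolCotangentAt ∧ ¬ P.IsAntiholCotangentAt` (the real-object half of [Liu2021, Prop. 4.13 proof, Case 1,
# «`V_π` is a character, hence `H¹(𝔤, K_G; π_∞) = 0`»])

Cell `hodgecm-mathlib` (D-0151), FLOOR 0, crux item H413 = stmt-HodgeConjecture-24833, programme P2; seat F0P2-p06 (g5), brick (F1) of the D1 survey of record
`F0/P2/F0P2-p06/g5/SURVEY-D1-thetaExhaustion.F0P2p06g5.md` §5 (= node N4 (ii) ∕ sub-stub K1c of `F0/P2/T5b-TREE.md`), desk F0P2-plan (g9) word 2026-09-01T02:01:22Z (1) «=».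
PROOF lane: theorems only, no `def`, no `sorry`, no named fact; `--supports stmt-HodgeConjecture-24833`.  HONEST LABEL: HC_CM is proved only modulo the printed citations
until rung 0 closes; this file discharges none of them — it is the in-house, real-object half of the sentence of [Liu2021] (proof of Prop. 4.13, Case 1, l. 2136,
p. 48) «By Corollary B.6 (1), `V_π` is a character, hence `H¹(𝔤, K_G; π_∞) = {0}`, which is a contradiction», the step that excludes the pole `s₀ = (n+1)/2` on
Liu's `L`-function road to letter A = D1 `Liu2021.cohHol_meetsThetaLiftFromLine` (#113).  It moves no digit (the survey's recommendation, adopted by the desk, keeps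
D1 a LETTER for the release); it is the reusable brick any in-house D1 road needs.

THE MATHEMATICS.  Fix the CM frame of programme P2 (`L` CM, `ι`, `H ∈ M₃(L)` with Sylvester frame `T` at `ι`), an automorphic measure `μ` and a discrete
automorphic `P ⊂ L²(U(H)(L⁺)\U(H)(𝔸_{L⁺}), μ)`.  Suppose `P` is ONE-DIMENSIONAL (`Module.finrank ℂ P = 1`; for instance `U(H)(𝔸)` acts on `P` through a character)
and `Φ ∈ holCotForms` is a holomorphic cotangent form whose two coordinate classes `v_j = [Φ·j] ∈ L²(μ)` lie in `P` (`P.IsHolCotangentAt`).  By the cotangent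
`K_∞`-type identity `Φ(x · ι_∞(k)) = ᵗJac(k, x₀) Φ(x)` for `k ∈ Stab_{U(2,1)}(x₀) = U(2) × U(1)` (★ `WeightForms.right_equiv`, ★ `BallForms.cotangentCocycle_apply`) and the
dictionary «right translation of forms = regular representation on classes» (★ `F0P2dStubSCotFormL2Data.rightRegular_toLp_toQuotFun_eq_sum_two`),
`R(ι_∞ k) v_j = Σ_i Jac(k, x₀)_{ij} v_i`.  With `P = ℂ w`, `v_j = c_j w` and `R(ι_∞ k) w = χ_k w` (invariance of `P`), so `ᵗJac(k, x₀) c = χ_k c` for every `k` in the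
isotropy group; `c ≠ 0` because a non-zero continuous form has a non-zero coordinate class for a measure positive on opens (★
`F0P2aCohFormsContinuous.exists_toLp_ne_zero_of_mem_cohForms_cm`).  But NO line of `T^*_{x₀}𝔹²` is stable under the isotropy group (★ `BallModel.irred`: some `k`
has `ᵗJac(k, x₀) c ∧ c ≠ 0`) — contradiction.  The antiholomorphic case is the same with `Jac` replaced by its complex conjugate (apply ★ `irred` to `c̄`).
In representation-theoretic words: the `K_∞`-type of a `(1,0)`- or `(0,1)`-class is the 2-dimensional IRREDUCIBLE isotropy representation `𝔭₊` resp. `𝔭₋`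
([BorelWallach2000, II §4.2, VI 4.7–4.8]; [Jacobowitz1990, Ch. 2 §1 Lemma 6 (2)]), which does not occur in a one-dimensional representation.

## References
* [Liu2021] Y. Liu, *Fourier–Jacobi cycles and arithmetic relative trace formula*, Camb. J. Math. 9 (2021), proof of Prop. 4.13, Case 1 (l. 2135–2136, p. 48).
* [BorelWallach2000] A. Borel, N. Wallach, *Continuous cohomology, discrete subgroups, and representations of reductive groups*, 2nd ed. (2000), II §4.2, VI 4.7–4.8, VII 2.10.
* [Jacobowitz1990] H. Jacobowitz, *An introduction to CR structures*, AMS (1990), Ch. 2 §1 Lemma 6 (2) p. 41.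
* [BorelJacquet1979] A. Borel, H. Jacquet, *Automorphic forms and automorphic representations*, PSPM 33.1 (1979), §4.2, §4.6.
-/

set_option autoImplicit false

-- the mandated namespace has the single-problem summit's repeated segment (`HodgeConjecture.HodgeConjecture`)
set_option linter.dupNamespace false

noncomputable section

namespace Summit.HodgeConjecture.HodgeConjecture.Cruxes.H413.F0P2oOneDimNotHolCotangent

open MeasureTheory NumberField MulAction
open scoped Matrix ComplexOrder
open Literature.NumberTheory.Automorphic Literature.NumberTheory.Automorphic.UnitaryGroup
open Literature.NumberTheory.Automorphic.UnitaryGroup.CotangentForms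
open Literature.NumberTheory.Automorphic.AutomorphyFactor
open Literature.AlgebraicGeometry.ShimuraVarieties Literature.AlgebraicGeometry.ShimuraVarieties.BallForms
open Literature.Geometry.ComplexHyperbolic Literature.Geometry.ComplexHyperbolic.BallModel
open Summit.HodgeConjecture.HodgeConjecture.Cruxes.H413.SpectrumJunction
open Summit.HodgeConjecture.HodgeConjecture.Cruxes.H413.F0P2aCohFormsContinuous
open Summit.HodgeConjecture.HodgeConjecture.Cruxes.H413.F0P2dStubSCotFormL2Data

variable (L : Type) [Field L] [NumberField L] [IsCMField L] (ι : L →+* ℂ) (H : Matrix (Fin 3) (Fin 3) L) (T : GL (Fin 3) ℂ)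
  (hT : (T : Matrix (Fin 3) (Fin 3) ℂ)ᴴ * H.map ι * (T : Matrix (Fin 3) (Fin 3) ℂ) = Literature.Geometry.ComplexHyperbolic.BallModel.J)
  (μ : Measure (adelicGroupData (↥(maximalRealSubfield L)) L (IsCMField.complexConj L) 3 H).automorphicQuotient)
  [(adelicGroupData (↥(maximalRealSubfield L)) L (IsCMField.complexConj L) 3 H).IsAutomorphicMeasure μ]

/-! ## §1 Linear algebra on `ℂ²`: an eigen-line of `ᵗM` has vanishing wedge -/

/-- `wedge (χ • c) c = 0`. [folklore] -/
theorem wedge_smul_self (χ : ℂ) (c : Fin 2 → ℂ) : wedge (χ • c) c = 0 := by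
  simp only [wedge, Pi.smul_apply, smul_eq_mul]
  ring

/-- The `j`-th coordinate of `ᵗM c` is `Σ_i M i j * c i`. [folklore] -/
theorem transpose_mulVec_apply (M : Matrix (Fin 2) (Fin 2) ℂ) (c : Fin 2 → ℂ) (j : Fin 2) :
    (Mᵀ *ᵥ c) j = ∑ i : Fin 2, M i j * c i := by
  simp only [Matrix.mulVec, dotProduct, Matrix.transpose_apply]

/-- Conjugating an eigen-relation of `ᵗ(M̄)`: `ᵗ(M̄) c = χ c ⇒ ᵗM c̄ = χ̄ c̄` (entrywise conjugation `M.map star`). [folklore] -/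
theorem transpose_map_star_mulVec_eq_smul {M : Matrix (Fin 2) (Fin 2) ℂ} {c : Fin 2 → ℂ} {χ : ℂ}
    (h : (M.map star)ᵀ *ᵥ c = χ • c) : Mᵀ *ᵥ star c = star χ • star c := by
  funext j
  have hj := congrArg star (congrFun h j)
  rw [transpose_mulVec_apply, Pi.smul_apply, smul_eq_mul] at hj
  simp only [star_sum, star_mul', Matrix.map_apply, star_star] at hj
  rw [transpose_mulVec_apply, Pi.smul_apply, smul_eq_mul]
  simp only [Pi.star_apply]
  exact hj

/-! ## §2 A one-dimensional `P`: coordinates along a generator, and the eigen-relation any `ℂ²`-type relation forces -/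

section OneDim

variable {K : Type} [Field K] [NumberField K] {𝒢 : AdelicGroupData.{0} K} {ν : Measure 𝒢.automorphicQuotient}
  [SMulInvariantMeasure 𝒢.Adelic 𝒢.automorphicQuotient ν]

/-- **One-dimensional `P`: two vectors of `P` have coordinates `c` along a generator, and every `ℂ²`-type relation `R(a) v_j = Σ_i M_{ij} v_i`
inside `P` forces `ᵗM c = χ c`** (`P = ℂ w`, `v_j = c_j w`, `R(a) w = χ w` by invariance of `P`); `c_j ≠ 0` whenever `v_j ≠ 0`.  The coordinate vector `c`
is produced BEFORE `a`, `M` are chosen. [cite: BorelJacquet1979, §4.6] -/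
theorem exists_coords_of_finrank_eq_one (P : DiscreteAutomorphicRep 𝒢 ν) (h1 : Module.finrank ℂ P.space.toSubmodule = 1)
    (v : Fin 2 → 𝒢.L2 ν) (hv : ∀ j, v j ∈ P.space.toSubmodule) :
    ∃ c : Fin 2 → ℂ, (∀ j, v j ≠ 0 → c j ≠ 0) ∧
      ∀ (a : 𝒢.Adelic) (M : Matrix (Fin 2) (Fin 2) ℂ), (∀ j, 𝒢.rightRegular ν a (v j) = ∑ i : Fin 2, M i j • v i) →
        ∃ χ : ℂ, Mᵀ *ᵥ c = χ • c := by
  obtain ⟨w, hw0, hw⟩ := finrank_eq_one_iff'.1 h1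
  choose c hc using fun j => hw ⟨v j, hv j⟩
  have hw0' : (w : 𝒢.L2 ν) ≠ 0 := fun h => hw0 (Subtype.ext h)
  have hcj : ∀ j, v j = c j • (w : 𝒢.L2 ν) := fun j => by
    have := congrArg Subtype.val (hc j)
    simpa using this.symm
  refine ⟨c, fun j hj h0 => hj (by rw [hcj j, h0, zero_smul]), fun a M hR => ?_⟩
  -- `R(a) w = χ w` by invariance and one-dimensionality of `P`
  have hwa : 𝒢.rightRegular ν a (w : 𝒢.L2 ν) ∈ P.space.toSubmodule := P.space.apply_mem_toSubmodule a w.2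
  obtain ⟨χ, hχ⟩ := hw ⟨_, hwa⟩
  have hχ' : 𝒢.rightRegular ν a (w : 𝒢.L2 ν) = χ • (w : 𝒢.L2 ν) := by
    have := congrArg Subtype.val hχ
    simpa using this.symm
  refine ⟨χ, funext fun j => ?_⟩
  -- compare the two expressions of `R(a) v_j` along `w`
  have hlhs : 𝒢.rightRegular ν a (v j) = (c j * χ) • (w : 𝒢.L2 ν) := by
    rw [hcj j, map_smul, hχ', smul_smul]
  have hrhs : ∑ i : Fin 2, M i j • v i = (∑ i : Fin 2, M i j * c i) • (w : 𝒢.L2 ν) := by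
    rw [Finset.sum_smul]
    exact Finset.sum_congr rfl fun i _ => by rw [hcj i, smul_smul]
  have heq : (c j * χ) • (w : 𝒢.L2 ν) = (∑ i : Fin 2, M i j * c i) • (w : 𝒢.L2 ν) := by rw [← hlhs, hR j, hrhs]
  have hinj := smul_left_injective ℂ hw0' heq
  rw [transpose_mulVec_apply, Pi.smul_apply, smul_eq_mul, ← hinj, mul_comm]

end OneDim

/-! ## §3 The CM frame: a one-dimensional `P` is neither holomorphic- nor antiholomorphic-cotangent -/

/-- The cotangent `K_∞`-type identity of a holomorphic cotangent form, coordinatewise: `Φ(x · ι_∞ k)_j = Σ_i Jac(k, x₀)_{ij} Φ(x)_i` for `k` in the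
isotropy group of `x₀` (★ `WeightForms.right_equiv`, ★ `BallForms.cotangentCocycle_apply`). [cite: BorelWallach2000, VII 2.10] [cite: Jacobowitz1990, Ch. 2 §1 Lemma 6 (2)] -/
theorem apply_mul_archSection_of_mem_holCotForms
    {Φ : (adelicGroupData (↥(maximalRealSubfield L)) L (IsCMField.complexConj L) 3 H).Adelic → (Fin 2 → ℂ)}
    (hΦ : Φ ∈ holCotForms (↥(maximalRealSubfield L)) L (IsCMField.complexConj L) 3 H (cmArchSection L ι H T hT) (cmCompactFactor L ι H T hT))
    (k : stabilizer U21 x₀) (x : (adelicGroupData (↥(maximalRealSubfield L)) L (IsCMField.complexConj L) 3 H).Adelic) (j : Fin 2) :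
    Φ (x * cmArchSection L ι H T hT k) j = ∑ i : Fin 2, Jac (k : U21) x₀ i j * Φ x i := by
  obtain ⟨hW, -, -, -⟩ := mem_holCotForms_iff.1 hΦ
  have h := WeightForms.right_equiv hW k x
  have e : Φ (x * cmArchSection L ι H T hT k) = (Jac (k : U21) x₀)ᵀ *ᵥ Φ x := by
    refine h.trans ?_
    rw [IsPullbackCocycle.weightOf_inv_apply, cotangentCocycle_apply]
  rw [e, transpose_mulVec_apply]

/-- The same for the ANTIholomorphic form `conjFun Φ`: `(conjFun Φ)(x · ι_∞ k)_j = Σ_i conj(Jac(k, x₀)_{ij}) (conjFun Φ)(x)_i`.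
[cite: BorelWallach2000, VII 2.10] -/
theorem conjFun_apply_mul_archSection_of_mem_holCotForms
    {Φ : (adelicGroupData (↥(maximalRealSubfield L)) L (IsCMField.complexConj L) 3 H).Adelic → (Fin 2 → ℂ)}
    (hΦ : Φ ∈ holCotForms (↥(maximalRealSubfield L)) L (IsCMField.complexConj L) 3 H (cmArchSection L ι H T hT) (cmCompactFactor L ι H T hT))
    (k : stabilizer U21 x₀) (x : (adelicGroupData (↥(maximalRealSubfield L)) L (IsCMField.complexConj L) 3 H).Adelic) (j : Fin 2) :
    conjFun (↥(maximalRealSubfield L)) L (IsCMField.complexConj L) 3 H Φ (x * cmArchSection L ι H T hT k) j =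
      ∑ i : Fin 2, ((Jac (k : U21) x₀).map star) i j * conjFun (↥(maximalRealSubfield L)) L (IsCMField.complexConj L) 3 H Φ x i := by
  have h := apply_mul_archSection_of_mem_holCotForms L ι H T hT hΦ k x j
  show star (Φ (x * cmArchSection L ι H T hT k)) j = ∑ i : Fin 2, ((Jac (k : U21) x₀).map star) i j * star (Φ x) i
  rw [Pi.star_apply, h, star_sum]
  refine Finset.sum_congr rfl fun i _ => ?_
  rw [star_mul', Matrix.map_apply, Pi.star_apply]

/-- **A ONE-DIMENSIONAL discrete `P` of `U(H)` is NOT holomorphic-cotangent at `ι`.**  [Liu2021, proof of Prop. 4.13 Case 1, l. 2136]: «`V_π` is a character, hence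
`H¹(𝔤, K_G; π_∞) = {0}`» — Hodge type `(1,0)`: the `K_∞`-type of a holomorphic cotangent class is the irreducible 2-dimensional isotropy representation, which no
line carries (★ `BallModel.irred`). [cite: Liu2021, Prop. 4.13 proof Case 1 (l. 2135–2136, p. 48)] [cite: BorelWallach2000, II §4.2; VI 4.7–4.8; VII 2.10]
[cite: Jacobowitz1990, Ch. 2 §1 Lemma 6 (2) p. 41] -/
theorem not_isHolCotangentAt_of_finrank_eq_one
    (P : DiscreteAutomorphicRep (adelicGroupData (↥(maximalRealSubfield L)) L (IsCMField.complexConj L) 3 H) μ)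
    (h1 : Module.finrank ℂ P.space.toSubmodule = 1) :
    ¬ P.IsHolCotangentAt (cmArchSection L ι H T hT) (cmCompactFactor L ι H T hT) := by
  rintro ⟨Φ, hΦ, hΦ0, hcont⟩
  have hleft := SpectrumJunction.leftInvariant_of_mem_holCotForms hΦ
  choose hm hmem using hcont
  -- some coordinate class is non-zero (`μ` is positive on opens)
  obtain ⟨j₀, hj₀⟩ := exists_toLp_ne_zero_of_mem_cohForms_cm (L := L) (ι := ι) (H := H) (T := T) (hT := hT)
    (holCotForms_le_cohForms hΦ) hΦ0 (p := 2) hm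
  -- coordinates along a generator of `P`
  obtain ⟨c, hc, hE⟩ := exists_coords_of_finrank_eq_one P h1 _ hmem
  have hc0 : c ≠ 0 := fun h0 => hc j₀ hj₀ (by rw [h0, Pi.zero_apply])
  -- an isotropy element moving the line `ℂ c`
  obtain ⟨k, hkx, hk⟩ := irred x₀ c hc0
  -- the type relation in `L²` at that element, hence an eigen-relation — contradiction
  obtain ⟨χ, hχ⟩ := hE (cmArchSection L ι H T hT (⟨k, mem_stabilizer_iff.2 hkx⟩ : stabilizer U21 x₀)) (Jac k x₀) fun j =>
    rightRegular_toLp_toQuotFun_eq_sum_two hleft hm _ j fun x =>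
      apply_mul_archSection_of_mem_holCotForms L ι H T hT hΦ ⟨k, mem_stabilizer_iff.2 hkx⟩ x j
  exact hk (by rw [hχ, wedge_smul_self])

/-- **A ONE-DIMENSIONAL discrete `P` of `U(H)` is NOT antiholomorphic-cotangent at `ι`** (Hodge type `(0,1)`; the same argument with `Jac` conjugated and ★
`BallModel.irred` applied to `c̄`). [cite: Liu2021, Prop. 4.13 proof Case 1 (l. 2135–2136, p. 48)] [cite: BorelWallach2000, II §4.2; VI 4.7–4.8; VII 2.10] -/
theorem not_isAntiholCotangentAt_of_finrank_eq_one
    (P : DiscreteAutomorphicRep (adelicGroupData (↥(maximalRealSubfield L)) L (IsCMField.complexConj L) 3 H) μ)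
    (h1 : Module.finrank ℂ P.space.toSubmodule = 1) :
    ¬ P.IsAntiholCotangentAt (cmArchSection L ι H T hT) (cmCompactFactor L ι H T hT) := by
  rintro ⟨Ψ, hΨ, hΨ0, hcont⟩
  have hcoh : Ψ ∈ cohForms (↥(maximalRealSubfield L)) L (IsCMField.complexConj L) 3 H (cmArchSection L ι H T hT) (cmCompactFactor L ι H T hT) :=
    le_sup_right (a := holCotForms (↥(maximalRealSubfield L)) L (IsCMField.complexConj L) 3 H (cmArchSection L ι H T hT) (cmCompactFactor L ι H T hT)) hΨ
  have hleft := SpectrumJunction.leftInvariant_of_mem_cohForms hcoh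
  choose hm hmem using hcont
  obtain ⟨j₀, hj₀⟩ := exists_toLp_ne_zero_of_mem_cohForms_cm (L := L) (ι := ι) (H := H) (T := T) (hT := hT) hcoh hΨ0 (p := 2) hm
  obtain ⟨c, hc, hE⟩ := exists_coords_of_finrank_eq_one P h1 _ hmem
  have hc0 : star c ≠ 0 := fun h0 => hc j₀ hj₀ (by simpa using congrFun h0 j₀)
  obtain ⟨k, hkx, hk⟩ := irred x₀ (star c) hc0
  obtain ⟨Φ, hΦ, rfl⟩ := Submodule.mem_map.1 hΨ
  obtain ⟨χ, hχ⟩ := hE (cmArchSection L ι H T hT (⟨k, mem_stabilizer_iff.2 hkx⟩ : stabilizer U21 x₀)) ((Jac k x₀).map star) fun j =>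
    rightRegular_toLp_toQuotFun_eq_sum_two hleft hm _ j fun x =>
      conjFun_apply_mul_archSection_of_mem_holCotForms L ι H T hT hΦ ⟨k, mem_stabilizer_iff.2 hkx⟩ x j
  exact hk (by rw [transpose_map_star_mulVec_eq_smul hχ, wedge_smul_self])

end Summit.HodgeConjecture.HodgeConjecture.Cruxes.H413.F0P2oOneDimNotHolCotangent

end
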